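import Mathlib
import Summits.ValiantsHypothesis.ValiantsHypothesis.Theorems.RigidityForcesSymmetryRankRigidMinimalReprLaplaceFourDefs
import Summits.ValiantsHypothesis.ValiantsHypothesis.Theorems.RigidityForcesSymmetryRankRigidMinimalReprLaplaceFourPencil
import Summits.ValiantsHypothesis.ValiantsHypothesis.Theorems.RigidityForcesSymmetryRankRigidMinimalReprLaplaceFourContraction

/-!
# The pencil at a general point of the torus, and the covering lemma
# (crux `RankRigidMinimalRepr`, stmt-ValiantsHypothesis-18034, route `RigidityForcesSymmetry`)

Tools for the five LINE profiles and the last profile `(2,2,1)` of the exact analysis of `LaplaceOptimal 4`, where the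
contraction `Q_{ψ,φ}` (`…LaplaceFourContraction.lean`) must be used at a GENERAL `φ ∈ (ℂˣ)⁴`, not only at `φ = 𝟙`:

* `Qgen ψ φ` — the sixteen entries of `Q_{ψ,φ}` written over an arbitrary commutative ring (so that `φ` may be the
  generic point `X` of `MvPolynomial (Fin 4) ℂ`); `Qgen_eq_contract`, `Qgen_map`;
* `torus_ten_lines` — for `φ` with all coordinates non-zero, if `Q_{ψ,φ}` is a sum of two rank-one products then
  `ψ` lies on one of ten lines depending on `φ`: the stars `ψ_a = cφ_a, ψ_k = -cφ_k (k ≠ a)` and the matchings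
  `ψ = c(φ_a e_a - φ_b e_b)` (from `pencil_ten_lines` by the diagonal scaling `Q_{φ∘t,φ} = D M(t) D`);
* `torus_rank_le_one` — if `Q_{ψ,φ}` is one rank-one product then `ψ = 0`;
* `covering` — if finitely many families of polynomials `p_j` have the property that at every point of the torus
  `(ℂˣ)⁴` some family vanishes entirely, then some family is identically zero (`MvPolynomial.funext_set` on the torus,
  which is a box with infinite sides, applied to a product of non-zero members).

HONEST FRAMING: bookkeeping toward `LaplaceOptimal 4` (rung `TiedTorusBound 3`); the crux stays OPEN; nothing here bears
on `VP ≠ VNP`.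
-/

set_option autoImplicit false

-- the mandated summit-side namespace repeats a component by design (single-problem summit)
set_option linter.dupNamespace false

namespace Summit.ValiantsHypothesis.ValiantsHypothesis.Theorems.RigidityForcesSymmetryRankRigidMinimalRepr

namespace LaplaceFourGeneric

open Matrix LaplaceFourPencil LaplaceFourContraction

/-! ### §1 The contraction over a general commutative ring -/

/-- The sixteen entries of `Q_{ψ,φ}` as a formula over any commutative ring. -/
def Qgen {R : Type*} [CommRing R] (ψ φ : Fin 4 → R) : Matrix (Fin 4) (Fin 4) R :=
  !![0, ψ 2 * φ 3 + ψ 3 * φ 2, ψ 1 * φ 3 + ψ 3 * φ 1, ψ 1 * φ 2 + ψ 2 * φ 1;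
    ψ 2 * φ 3 + ψ 3 * φ 2, 0, ψ 0 * φ 3 + ψ 3 * φ 0, ψ 0 * φ 2 + ψ 2 * φ 0;
    ψ 1 * φ 3 + ψ 3 * φ 1, ψ 0 * φ 3 + ψ 3 * φ 0, 0, ψ 0 * φ 1 + ψ 1 * φ 0;
    ψ 1 * φ 2 + ψ 2 * φ 1, ψ 0 * φ 2 + ψ 2 * φ 0, ψ 0 * φ 1 + ψ 1 * φ 0, 0]

/-- Over `ℂ`, `Qgen` is the contraction of the pattern. -/
theorem Qgen_eq_contract (ψ φ : Fin 4 → ℂ) : Qgen ψ φ = contract₀₁ permPattern₄ ψ φ := by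
  rw [contract_permPattern_entries]; rfl

/-- `Qgen` commutes with ring homomorphisms (e.g. evaluation of polynomials). -/
theorem Qgen_map {R S : Type*} [CommRing R] [CommRing S] (f : R →+* S) (ψ φ : Fin 4 → R) :
    (Qgen ψ φ).map f = Qgen (f ∘ ψ) (f ∘ φ) := by
  ext i j
  fin_cases i <;> fin_cases j <;> simp [Qgen, map_add, map_mul]

/-! ### §2 The pencil at a point of the torus -/

/-- Diagonal scaling: for `φ ∈ (ℂˣ)⁴`, `Q_{ψ,φ}(z,w) = φ_z φ_w · M(t)(z,w) · … ` — precisely, with `t_x = ψ_x / φ_x`,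
`Q_{ψ,φ}(z,w) · φ_z φ_w = (Π φ) · M(t)(z,w)`. -/
theorem contract_torus_scaling (ψ φ : Fin 4 → ℂ) (hφ : ∀ i, φ i ≠ 0) (z w : Fin 4) :
    contract₀₁ permPattern₄ ψ φ z w * (φ z * φ w) =
      (φ 0 * φ 1 * φ 2 * φ 3) *
        (if z = w then (0 : ℂ) else (∑ i, ψ i / φ i) - ψ z / φ z - ψ w / φ w) := by
  rw [contract_permPattern_entries, Fin.sum_univ_four]
  have h0 := hφ 0; have h1 := hφ 1; have h2 := hφ 2; have h3 := hφ 3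
  fin_cases z <;> fin_cases w <;> simp <;> field_simp <;> ring

/-- **Ten lines at a torus point.**  If all `φ_i ≠ 0` and `Q_{ψ,φ}` is a sum of two rank-one products, then `ψ` is on a
star `ψ_a = cφ_a`, `ψ_k = -cφ_k` (`k ≠ a`), or on a matching `ψ_a = cφ_a`, `ψ_b = -cφ_b`, `ψ = 0` elsewhere. -/
theorem torus_ten_lines (ψ φ : Fin 4 → ℂ) (hφ : ∀ i, φ i ≠ 0) (a b a' b' : Fin 4 → ℂ)
    (h : contract₀₁ permPattern₄ ψ φ = vecMulVec a b + vecMulVec a' b') :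
    (∃ i : Fin 4, ∃ c : ℂ, ∀ j, ψ j = if j = i then c * φ j else -(c * φ j)) ∨
    (∃ i j : Fin 4, i ≠ j ∧ (∀ k, k ≠ i → k ≠ j → ψ k = 0) ∧ ψ i / φ i + ψ j / φ j = 0) := by
  set t : Fin 4 → ℂ := fun i => ψ i / φ i with ht
  set pr : ℂ := φ 0 * φ 1 * φ 2 * φ 3 with hpr
  have hpr0 : pr ≠ 0 := by
    rw [hpr]; exact mul_ne_zero (mul_ne_zero (mul_ne_zero (hφ 0) (hφ 1)) (hφ 2)) (hφ 3)
  -- `M(t) = (φ∘a/Π·φ) ⊗ (φ∘b) + …` : two rank-one products again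
  have key : ∀ z w : Fin 4, (if z = w then (0 : ℂ) else (∑ i, t i) - t z - t w) =
      (φ z * a z / pr) * (φ w * b w) + (φ z * a' z / pr) * (φ w * b' w) := by
    intro z w
    have hs := contract_torus_scaling ψ φ hφ z w
    have hzw : contract₀₁ permPattern₄ ψ φ z w = a z * b w + a' z * b' w := by
      rw [h]; simp [vecMulVec_apply]
    rw [hzw, ← hpr] at hs
    simp only [ht]
    have : (if z = w then (0 : ℂ) else (∑ i, ψ i / φ i) - ψ z / φ z - ψ w / φ w) =
        (a z * b w + a' z * b' w) * (φ z * φ w) / pr := by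
      rw [eq_div_iff hpr0, mul_comm]; exact hs.symm
    rw [this]; field_simp
  rcases pencil_ten_lines t _ _ _ _ key with ⟨i, c, hc⟩ | ⟨i, j, hij, hk, hs⟩
  · left
    refine ⟨i, c, fun j => ?_⟩
    have := hc j
    simp only [ht] at this
    split_ifs at this ⊢ with hji
    · rw [(div_eq_iff (hφ j)).1 this]
    · rw [(div_eq_iff (hφ j)).1 this]; ring
  · right
    refine ⟨i, j, hij, fun k hki hkj => ?_, by simpa [ht] using hs⟩
    have := hk k hki hkj
    simp only [ht, div_eq_zero_iff] at this
    exact this.resolve_right (hφ k)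

/-- **One rank-one product at a torus point forces `ψ = 0`.** -/
theorem torus_rank_le_one (ψ φ : Fin 4 → ℂ) (hφ : ∀ i, φ i ≠ 0) (a b : Fin 4 → ℂ)
    (h : contract₀₁ permPattern₄ ψ φ = vecMulVec a b) : ψ = 0 := by
  have hv : ∀ z w, contract₀₁ permPattern₄ ψ φ z w = a z * b w := fun z w => by rw [h, vecMulVec_apply]
  have hsymm : ∀ z w : Fin 4, contract₀₁ permPattern₄ ψ φ z w = contract₀₁ permPattern₄ ψ φ w z := by
    intro z w; rw [contract_permPattern_entries]; fin_cases z <;> fin_cases w <;> simp [mul_comm]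
  have hdiag : ∀ z : Fin 4, contract₀₁ permPattern₄ ψ φ z z = 0 := by
    intro z; rw [contract_permPattern_entries]; fin_cases z <;> simp
  have h0 := symm_rank_one_eq_zero (fun z w => contract₀₁ permPattern₄ ψ φ z w) a b hsymm hdiag hv
  have e := contract_permPattern_entries ψ φ
  have e23 := h0 2 3; have e13 := h0 1 3; have e12 := h0 1 2; have e01 := h0 0 1; have e02 := h0 0 2
  have e03 := h0 0 3
  rw [e] at e23 e13 e12 e01 e02 e03
  simp at e23 e13 e12 e01 e02 e03
  -- `ψ_x φ_y + ψ_y φ_x = 0` for all pairs, with all `φ ≠ 0`, forces `ψ = 0`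
  have h0' := hφ 0; have h1' := hφ 1; have h2' := hφ 2; have h3' := hφ 3
  -- from pairs (0,1),(0,2),(1,2): ψ₀ = ψ₁ = ψ₂ = 0
  have q0 : ψ 0 * (φ 1 * φ 2) = 0 := by
    have : ψ 0 * φ 1 * φ 2 * 2 = (ψ 0 * φ 1 + ψ 1 * φ 0) * φ 2 + (ψ 0 * φ 2 + ψ 2 * φ 0) * φ 1 -
        (ψ 1 * φ 2 + ψ 2 * φ 1) * φ 0 := by ring
    rw [e23, e13, e03] at this
    linear_combination this / 2
  have hψ0 : ψ 0 = 0 := (mul_eq_zero.1 q0).resolve_right (mul_ne_zero h1' h2')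
  have hψ1 : ψ 1 = 0 := by
    have : ψ 1 * φ 0 = 0 := by linear_combination e23 - φ 1 * hψ0
    exact (mul_eq_zero.1 this).resolve_right h0'
  have hψ2 : ψ 2 = 0 := by
    have : ψ 2 * φ 0 = 0 := by linear_combination e13 - φ 2 * hψ0
    exact (mul_eq_zero.1 this).resolve_right h0'
  have hψ3 : ψ 3 = 0 := by
    have : ψ 3 * φ 0 = 0 := by linear_combination e12 - φ 3 * hψ0
    exact (mul_eq_zero.1 this).resolve_right h0'
  funext i; fin_cases i <;> assumption

/-! ### §3 The covering lemma -/

/-- **Covering lemma.**  If finitely many finite families of polynomials in four variables are such that at every point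
of the torus `(ℂˣ)⁴` at least one family vanishes entirely, then one family vanishes identically. -/
theorem covering {ι κ : Type*} [Fintype ι] [DecidableEq ι] [Fintype κ] (p : ι → κ → MvPolynomial (Fin 4) ℂ)
    (h : ∀ φ : Fin 4 → ℂ, (∀ i, φ i ≠ 0) → ∃ j, ∀ k, MvPolynomial.eval φ (p j k) = 0) :
    ∃ j, ∀ k, p j k = 0 := by
  by_contra hne
  push Not at hne
  choose k hk using hne
  set P : MvPolynomial (Fin 4) ℂ := ∏ j, p j (k j) with hP
  have hP0 : P ≠ 0 := Finset.prod_ne_zero_iff.2 fun j _ => hk j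
  apply hP0
  apply MvPolynomial.funext_set (fun _ : Fin 4 => {z : ℂ | z ≠ 0}) (fun _ => ?_)
  · intro φ hφ
    have hφ' : ∀ i, φ i ≠ 0 := fun i => hφ i (Set.mem_univ i)
    obtain ⟨j, hj⟩ := h φ hφ'
    rw [map_zero, hP, map_prod]
    exact Finset.prod_eq_zero (Finset.mem_univ j) (hj (k j))
  · exact Set.infinite_of_injective_forall_mem (f := fun n : ℕ => ((n : ℂ) + 1))
      (fun m n hmn => by simpa using hmn) (fun n => by
        simp only [Set.mem_setOf_eq]; exact_mod_cast Nat.succ_ne_zero n)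

end LaplaceFourGeneric

end Summit.ValiantsHypothesis.ValiantsHypothesis.Theorems.RigidityForcesSymmetryRankRigidMinimalRepr
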